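import Mathlib.Analysis.Complex.Basic
import Mathlib.Algebra.Order.Floor.Ring
import Mathlib.Logic.Equiv.Fin.Basic
import HarnessLib

/-!
# Conformal removability: shifted dyadic grids in the plane and the one-third trick

Support for the proof of `JonesSmirnov2000_frontier_of_isHolderDomain` (Jones–Smirnov 2000,
Cor. 2; `ConformalRemovability.lean`), geometric input of the Koskela–Rohde dimension estimate for
mean porous sets (P. Koskela, S. Rohde, *Hausdorff dimension and mean porosity*, Math. Ann. 309
(1997) 593–609, Thm. 2.1), whose tree-counting core is `ConformalRemovabilityTreeCount.lean`.

Nodes are triples `D = (n, i, j) : ℤ × ℤ × ℤ` (level `n`, side length `Dyadic.len n = 2^{-n}`);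
`Dyadic.sq t D` is the half-open square `t + 2^{-n} ([i, i+1) × [j, j+1)) ⊆ ℂ` of the dyadic grid
shifted by `t : ℝ × ℝ`; `Dyadic.par` (parent), `Dyadic.code` (quadrant, `Fin 4`) and
`Dyadic.nodeOf t n z` (the level-`n` node whose square contains `z`) organise the squares into the
`4`-ary tree required by `card_le_of_good_ancestors`:

* `Dyadic.eq_of_par_eq_of_code_eq` — parent and quadrant determine the node;
* `Dyadic.mem_sq_iff`, `Dyadic.mem_sq_nodeOf`, `Dyadic.eq_nodeOf_of_mem`, `Dyadic.par_nodeOf`,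
  `Dyadic.iterate_par_nodeOf`, `Dyadic.sq_subset_sq_iterate_par` (nesting),
  `Dyadic.sq_subset_sq_of_mem` (a finer square meeting a coarser one lies inside it),
  `Dyadic.dist_lt_of_mem_sq` (diameter `< 2 · 2^{-n}`);
* the **one-third trick**: among the shifts `a ∈ {0, 1/3, 2/3}` at most one lets an interval of
  length `< 2^{-k}/3` (`k ≥ 1`) straddle a grid point (`Dyadic.thirds_eq_of_straddle`), hence a disc
  of radius `ρ ≤ 2^{-k}/6` lies inside a single level-`k` square for at least `4` of the `9` shifts
  `(a/3, b/3)` (`Dyadic.four_le_card_good_shifts`).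

## References

* P. Koskela, S. Rohde, Math. Ann. 309 (1997) 593–609, §2; the one-third trick is [folklore]
  (M. Christ; K. Okikiolu, J. London Math. Soc. 46 (1992)).
-/

noncomputable section

open Set Metric

namespace Literature.Probability.RandomPlanarGeometry

namespace Dyadic

/-! ### Side lengths, parents, quadrants -/

/-- The side length `2^{-n}` of a level-`n` dyadic square. [folklore] -/
def len (n : ℤ) : ℝ := (2 : ℝ) ^ (-n)

/-- Side lengths are positive. [folklore] -/
theorem len_pos (n : ℤ) : 0 < len n := zpow_pos (by norm_num) _

/-- One level up the side length doubles. [folklore] -/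
theorem len_sub_one (n : ℤ) : len (n - 1) = 2 * len n := by
  simp only [len, neg_sub]
  rw [show (1 : ℤ) - n = -n + 1 by ring, zpow_add₀ (two_ne_zero (α := ℝ)), zpow_one]
  ring

/-- `len k = 1/2^k` for natural levels. [folklore] -/
theorem len_natCast (k : ℕ) : len k = 1 / 2 ^ k := by
  simp [len, zpow_neg, zpow_natCast]

/-- The parent node (one level up). [folklore] -/
def par (D : ℤ × ℤ × ℤ) : ℤ × ℤ × ℤ := (D.1 - 1, D.2.1 / 2, D.2.2 / 2)

/-- `i % 2 ∈ {0, 1}`. [folklore] -/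
theorem toNat_emod_two_lt (i : ℤ) : (i % 2).toNat < 2 := by
  have h0 : 0 ≤ i % 2 := Int.emod_nonneg _ two_ne_zero
  have h1 : i % 2 < 2 := Int.emod_lt_of_pos _ two_pos
  omega

/-- The quadrant of a node inside its parent, coded in `Fin 4`. [folklore] -/
def code (D : ℤ × ℤ × ℤ) : Fin 4 :=
  finProdFinEquiv (⟨(D.2.1 % 2).toNat, toNat_emod_two_lt _⟩, ⟨(D.2.2 % 2).toNat, toNat_emod_two_lt _⟩)

/-- **Parent and quadrant determine the node.** [folklore] -/
theorem eq_of_par_eq_of_code_eq (D D' : ℤ × ℤ × ℤ) (hp : par D = par D') (hc : code D = code D') :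
    D = D' := by
  obtain ⟨n, i, j⟩ := D
  obtain ⟨n', i', j'⟩ := D'
  simp only [par, Prod.mk.injEq] at hp
  obtain ⟨hn, hi, hj⟩ := hp
  have hc' := finProdFinEquiv.injective hc
  simp only [Prod.mk.injEq, Fin.mk.injEq] at hc'
  obtain ⟨hci, hcj⟩ := hc'
  have key : ∀ a b : ℤ, a / 2 = b / 2 → (a % 2).toNat = (b % 2).toNat → a = b := by
    intro a b hab hmod
    have ha := Int.emod_nonneg a two_ne_zero
    have hb := Int.emod_nonneg b two_ne_zero
    have hmod' : a % 2 = b % 2 := by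
      have h1 : ((a % 2).toNat : ℤ) = a % 2 := Int.toNat_of_nonneg ha
      have h2 : ((b % 2).toNat : ℤ) = b % 2 := Int.toNat_of_nonneg hb
      rw [← h1, ← h2, hmod]
    have ea := Int.emod_add_mul_ediv a 2
    have eb := Int.emod_add_mul_ediv b 2
    omega
  simp only [Prod.mk.injEq]
  exact ⟨by omega, key i i' hi hci, key j j' hj hcj⟩

/-! ### Squares and the node of a point -/

/-- The half-open square of the node `D = (n, i, j)` in the dyadic grid shifted by `t`:
`{z | re z ∈ t₁ + 2^{-n}[i, i+1), im z ∈ t₂ + 2^{-n}[j, j+1)}`. [folklore] -/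
def sq (t : ℝ × ℝ) (D : ℤ × ℤ × ℤ) : Set ℂ :=
  {z | t.1 + D.2.1 * len D.1 ≤ z.re ∧ z.re < t.1 + (D.2.1 + 1) * len D.1 ∧
    t.2 + D.2.2 * len D.1 ≤ z.im ∧ z.im < t.2 + (D.2.2 + 1) * len D.1}

/-- The level-`n` node whose (shifted) square contains `z`. [folklore] -/
def nodeOf (t : ℝ × ℝ) (n : ℤ) (z : ℂ) : ℤ × ℤ × ℤ :=
  (n, ⌊(z.re - t.1) / len n⌋, ⌊(z.im - t.2) / len n⌋)

/-- `⌊x/ℓ⌋ = i ↔ iℓ ≤ x < (i+1)ℓ` (`ℓ > 0`). [folklore] -/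
theorem floor_div_eq_iff {x ℓ : ℝ} (hℓ : 0 < ℓ) (i : ℤ) :
    ⌊x / ℓ⌋ = i ↔ i * ℓ ≤ x ∧ x < (i + 1) * ℓ := by
  rw [Int.floor_eq_iff, le_div_iff₀ hℓ, div_lt_iff₀ hℓ]

/-- Membership in a square in terms of floors. [folklore] -/
theorem mem_sq_iff (t : ℝ × ℝ) (D : ℤ × ℤ × ℤ) (z : ℂ) :
    z ∈ sq t D ↔ ⌊(z.re - t.1) / len D.1⌋ = D.2.1 ∧ ⌊(z.im - t.2) / len D.1⌋ = D.2.2 := by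
  rw [floor_div_eq_iff (len_pos _), floor_div_eq_iff (len_pos _)]
  simp only [sq, mem_setOf_eq]
  constructor
  · rintro ⟨h1, h2, h3, h4⟩
    exact ⟨⟨by linarith, by linarith⟩, ⟨by linarith, by linarith⟩⟩
  · rintro ⟨⟨h1, h2⟩, ⟨h3, h4⟩⟩
    exact ⟨by linarith, by linarith, by linarith, by linarith⟩

/-- Every point lies in the square of its node. [folklore] -/
theorem mem_sq_nodeOf (t : ℝ × ℝ) (n : ℤ) (z : ℂ) : z ∈ sq t (nodeOf t n z) := by
  rw [mem_sq_iff]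
  exact ⟨rfl, rfl⟩

/-- The square containing a point at a given level is unique. [folklore] -/
theorem eq_nodeOf_of_mem {t : ℝ × ℝ} {D : ℤ × ℤ × ℤ} {z : ℂ} (hz : z ∈ sq t D) :
    D = nodeOf t D.1 z := by
  rw [mem_sq_iff] at hz
  obtain ⟨n, i, j⟩ := D
  simp only [nodeOf, Prod.mk.injEq]
  exact ⟨trivial, hz.1.symm, hz.2.symm⟩

/-- The parent of the node of a point is the node of the point one level up. [folklore] -/
theorem par_nodeOf (t : ℝ × ℝ) (n : ℤ) (z : ℂ) : par (nodeOf t n z) = nodeOf t (n - 1) z := by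
  have key : ∀ x : ℝ, ⌊x / len n⌋ / 2 = ⌊x / len (n - 1)⌋ := fun x => by
    rw [len_sub_one, mul_comm, ← div_div,
      show ⌊x / len n / 2⌋ = ⌊x / len n / ((2 : ℕ) : ℝ)⌋ by norm_num, Int.floor_div_natCast]
    norm_num
  simp only [par, nodeOf, key]

/-- Iterated parents of the node of a point. [folklore] -/
theorem iterate_par_nodeOf (t : ℝ × ℝ) (n : ℤ) (z : ℂ) (k : ℕ) :
    par^[k] (nodeOf t n z) = nodeOf t (n - k) z := by
  induction k with
  | zero => simp
  | succ k ih =>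
    rw [Function.iterate_succ_apply', ih, par_nodeOf]
    congr 1
    push_cast
    ring

/-- **Nesting**: a square lies inside the squares of its ancestors. [folklore] -/
theorem sq_subset_sq_iterate_par (t : ℝ × ℝ) (D : ℤ × ℤ × ℤ) (k : ℕ) :
    sq t D ⊆ sq t (par^[k] D) := by
  intro z hz
  rw [eq_nodeOf_of_mem hz, iterate_par_nodeOf]
  exact mem_sq_nodeOf t _ z

/-- Levels decrease by one under `par`. [folklore] -/
theorem iterate_par_fst (D : ℤ × ℤ × ℤ) (k : ℕ) : (par^[k] D).1 = D.1 - k := by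
  induction k with
  | zero => simp
  | succ k ih =>
    rw [Function.iterate_succ_apply']
    simp only [par, ih]
    push_cast
    ring

/-- **A finer square meeting a coarser one lies inside it.** [folklore] -/
theorem sq_subset_sq_of_mem {t : ℝ × ℝ} {D D' : ℤ × ℤ × ℤ} {k : ℕ} (hlev : D'.1 = D.1 + k)
    {z : ℂ} (hz' : z ∈ sq t D') (hz : z ∈ sq t D) : sq t D' ⊆ sq t D := by
  have hD : D = nodeOf t D.1 z := eq_nodeOf_of_mem hz
  have hD' : D' = nodeOf t D'.1 z := eq_nodeOf_of_mem hz'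
  have h1 : par^[k] D' = D := by
    rw [hD', iterate_par_nodeOf, hlev, show D.1 + (k : ℤ) - k = D.1 by ring]
    exact hD.symm
  rw [← h1]
  exact sq_subset_sq_iterate_par t D' k

/-- **Diameter**: two points of a level-`n` square are at distance `< 2 · 2^{-n}`. [folklore] -/
theorem dist_lt_of_mem_sq {t : ℝ × ℝ} {D : ℤ × ℤ × ℤ} {z w : ℂ} (hz : z ∈ sq t D)
    (hw : w ∈ sq t D) : dist z w < 2 * len D.1 := by
  obtain ⟨h1, h2, h3, h4⟩ := hz
  obtain ⟨g1, g2, g3, g4⟩ := hw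
  have hre : |(z - w).re| < len D.1 := by
    rw [Complex.sub_re, abs_sub_lt_iff]
    constructor <;> linarith
  have him : |(z - w).im| < len D.1 := by
    rw [Complex.sub_im, abs_sub_lt_iff]
    constructor <;> linarith
  calc dist z w = ‖z - w‖ := dist_eq_norm z w
    _ ≤ |(z - w).re| + |(z - w).im| := Complex.norm_le_abs_re_add_abs_im _
    _ < 2 * len D.1 := by linarith

/-! ### The one-third trick -/

/-- The thirds `e/3 + i/2^k` (`e ∈ {±1, ±2}`, `i ∈ ℤ`, `k ≥ 0`) are at least `1/(3 · 2^k)` in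
absolute value: `3 ∤ e 2^k`. [folklore] -/
theorem abs_thirds_add_ge {e i : ℤ} (he : e = 1 ∨ e = -1 ∨ e = 2 ∨ e = -2) (k : ℕ) :
    1 / (3 * 2 ^ k) ≤ |(e : ℝ) / 3 + i / 2 ^ k| := by
  have hne : e * 2 ^ k + 3 * i ≠ 0 := by
    intro h
    have h3 : (3 : ℤ) ∣ e * 2 ^ k := ⟨-i, by linarith⟩
    have hcop : IsCoprime (3 : ℤ) (2 ^ k) := by
      apply IsCoprime.pow_right
      rw [Int.isCoprime_iff_gcd_eq_one]
      rfl
    have h3e : (3 : ℤ) ∣ e := hcop.dvd_of_dvd_mul_right h3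
    rcases he with rfl | rfl | rfl | rfl <;> omega
  have h1 : (1 : ℝ) ≤ |((e * 2 ^ k + 3 * i : ℤ) : ℝ)| := by
    rw [← Int.cast_abs]
    exact_mod_cast Int.one_le_abs hne
  have hpos : (0 : ℝ) < 3 * 2 ^ k := by positivity
  have heq : (e : ℝ) / 3 + i / 2 ^ k = ((e * 2 ^ k + 3 * i : ℤ) : ℝ) / (3 * 2 ^ k) := by
    push_cast
    field_simp
  rw [heq, abs_div, abs_of_pos hpos]
  exact div_le_div_of_nonneg_right h1 hpos.le

/-- An interval `(x - ρ, x + ρ)` whose points do not all have the same floor after scaling by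
`2^k` and shifting by `a` contains a grid point `a + j/2^k` within `ρ` of `x`. [folklore] -/
theorem exists_grid_point_of_floor_ne {x y a ρ : ℝ} {k : ℕ} (hy : |y - x| < ρ)
    (hne : ⌊(y - a) * 2 ^ k⌋ ≠ ⌊(x - a) * 2 ^ k⌋) : ∃ j : ℤ, |a + j / 2 ^ k - x| < ρ := by
  have h2 : (0 : ℝ) < 2 ^ k := by positivity
  set u := (x - a) * 2 ^ k with hu
  set v := (y - a) * 2 ^ k with hv
  -- a grid point between `x` and `y`
  have key : ∀ {p q : ℝ}, ⌊p⌋ < ⌊q⌋ → ∃ j : ℤ, p < j ∧ (j : ℝ) ≤ q := fun {p q} h =>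
    ⟨⌊q⌋, by
      have := Int.floor_le q
      have h' : (⌊p⌋ : ℝ) + 1 ≤ ⌊q⌋ := by exact_mod_cast h
      constructor
      · linarith [Int.lt_floor_add_one p]
      · exact this⟩
  rcases lt_or_gt_of_ne hne with h | h
  · obtain ⟨j, hj1, hj2⟩ := key h
    refine ⟨j, ?_⟩
    -- `x ... a + j/2^k ≤ y` hmm: from `v < j ≤ u`: grid point between y and x
    have e1 : a + j / 2 ^ k - x = (j - u) / 2 ^ k := by rw [hu]; field_simp; ring
    have e2 : y - x = (v - u) / 2 ^ k := by rw [hu, hv]; field_simp; ring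
    rw [e1, abs_div, abs_of_pos h2, div_lt_iff₀ h2]
    rw [e2, abs_div, abs_of_pos h2, div_lt_iff₀ h2] at hy
    have : |(j : ℝ) - u| ≤ |v - u| := by
      rw [abs_of_nonpos (by linarith), abs_of_nonpos (by linarith)]
      linarith
    linarith
  · obtain ⟨j, hj1, hj2⟩ := key h
    refine ⟨j, ?_⟩
    have e1 : a + j / 2 ^ k - x = (j - u) / 2 ^ k := by rw [hu]; field_simp; ring
    have e2 : y - x = (v - u) / 2 ^ k := by rw [hu, hv]; field_simp; ring
    rw [e1, abs_div, abs_of_pos h2, div_lt_iff₀ h2]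
    rw [e2, abs_div, abs_of_pos h2, div_lt_iff₀ h2] at hy
    have : |(j : ℝ) - u| ≤ |v - u| := by
      rw [abs_of_pos (by linarith), abs_of_pos (by linarith)]
      linarith
    linarith

/-- **The one-third trick (one dimension).** Let `k ≥ 0` and `ρ ≤ 1/(6 · 2^k)`. If for two shifts `p/3`, `p'/3` (`p, p' ∈ {0, 1, 2}`) the interval
`(x - ρ, x + ρ)` is not contained in a single grid interval of mesh `2^{-k}`, then `p = p'`.
[folklore] -/
theorem thirds_eq_of_straddle {x ρ : ℝ} {k : ℕ} (hρ : ρ ≤ 1 / (6 * 2 ^ k)) {p p' : ℕ}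
    (hp : p < 3) (hp' : p' < 3)
    (h : ∃ y, |y - x| < ρ ∧ ⌊(y - p / 3) * 2 ^ k⌋ ≠ ⌊(x - p / 3) * 2 ^ k⌋)
    (h' : ∃ y, |y - x| < ρ ∧ ⌊(y - p' / 3) * 2 ^ k⌋ ≠ ⌊(x - p' / 3) * 2 ^ k⌋) : p = p' := by
  by_contra hpp
  obtain ⟨y, hy, hne⟩ := h
  obtain ⟨y', hy', hne'⟩ := h'
  obtain ⟨j, hj⟩ := exists_grid_point_of_floor_ne hy hne
  obtain ⟨j', hj'⟩ := exists_grid_point_of_floor_ne hy' hne'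
  -- the two grid points are within `2ρ ≤ 1/(3·2^k)` of each other
  have hclose : |((p : ℤ) - p' : ℤ) / (3 : ℝ) + ((j - j' : ℤ) : ℝ) / 2 ^ k| < 1 / (3 * 2 ^ k) := by
    have : ((p : ℤ) - p' : ℤ) / (3 : ℝ) + ((j - j' : ℤ) : ℝ) / 2 ^ k =
        (p / 3 + j / 2 ^ k - x) - (p' / 3 + j' / 2 ^ k - x) := by
      push_cast
      ring
    rw [this]
    calc |(p / 3 + j / 2 ^ k - x) - (p' / 3 + j' / 2 ^ k - x)|
        ≤ |(p : ℝ) / 3 + j / 2 ^ k - x| + |(p' : ℝ) / 3 + j' / 2 ^ k - x| := abs_sub _ _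
      _ < ρ + ρ := add_lt_add hj hj'
      _ ≤ 1 / (3 * 2 ^ k) := by
          have : (0 : ℝ) < 2 ^ k := by positivity
          rw [show ρ + ρ = 2 * ρ by ring]
          calc 2 * ρ ≤ 2 * (1 / (6 * 2 ^ k)) := by linarith
            _ = 1 / (3 * 2 ^ k) := by field_simp; ring
  have he : ((p : ℤ) - p' = 1 ∨ (p : ℤ) - p' = -1 ∨ (p : ℤ) - p' = 2 ∨ (p : ℤ) - p' = -2) := by
    omega
  have := abs_thirds_add_ge he (i := j - j') k
  linarith

open scoped Classical in
/-- **The one-third trick (plane).** For `k ≥ 0` and `0 < ρ ≤ 1/(6 · 2^k)`, the disc `B(z, ρ)`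
lies inside a single level-`k` square of the grid shifted by `(p/3, p'/3)` for at least `4` of the
`9` pairs `(p, p') ∈ {0,1,2}²` (all points of the disc have the same level-`k` node).
[folklore] -/
theorem four_le_card_good_shifts (z : ℂ) {ρ : ℝ} {k : ℕ} (hρ : ρ ≤ 1 / (6 * 2 ^ k)) :
    4 ≤ ((Finset.range 3 ×ˢ Finset.range 3).filter fun pq : ℕ × ℕ =>
      ∀ w, dist w z < ρ → nodeOf ((pq.1 : ℝ) / 3, (pq.2 : ℝ) / 3) k w =
        nodeOf ((pq.1 : ℝ) / 3, (pq.2 : ℝ) / 3) k z).card := by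
  classical
  -- bad shifts in each coordinate
  set B1 : Finset ℕ := (Finset.range 3).filter fun p =>
    ∃ y, |y - z.re| < ρ ∧ ⌊(y - p / 3) * 2 ^ k⌋ ≠ ⌊(z.re - p / 3) * 2 ^ k⌋ with hB1
  set B2 : Finset ℕ := (Finset.range 3).filter fun p =>
    ∃ y, |y - z.im| < ρ ∧ ⌊(y - p / 3) * 2 ^ k⌋ ≠ ⌊(z.im - p / 3) * 2 ^ k⌋ with hB2
  have hB1c : B1.card ≤ 1 := Finset.card_le_one.2 fun p hp p' hp' => by
    simp only [hB1, Finset.mem_filter, Finset.mem_range] at hp hp'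
    exact thirds_eq_of_straddle hρ hp.1 hp'.1 hp.2 hp'.2
  have hB2c : B2.card ≤ 1 := Finset.card_le_one.2 fun p hp p' hp' => by
    simp only [hB2, Finset.mem_filter, Finset.mem_range] at hp hp'
    exact thirds_eq_of_straddle hρ hp.1 hp'.1 hp.2 hp'.2
  -- good pairs contain (range 3 \ B1) × (range 3 \ B2)
  have hsub : (Finset.range 3 \ B1) ×ˢ (Finset.range 3 \ B2) ⊆
      (Finset.range 3 ×ˢ Finset.range 3).filter fun pq : ℕ × ℕ =>
        ∀ w, dist w z < ρ → nodeOf ((pq.1 : ℝ) / 3, (pq.2 : ℝ) / 3) k w =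
          nodeOf ((pq.1 : ℝ) / 3, (pq.2 : ℝ) / 3) k z := by
    intro pq hpq
    simp only [Finset.mem_product, Finset.mem_sdiff, Finset.mem_range, hB1, hB2,
      Finset.mem_filter, not_and, not_exists] at hpq
    obtain ⟨⟨h1, h1'⟩, ⟨h2, h2'⟩⟩ := hpq
    simp only [Finset.mem_filter, Finset.mem_product, Finset.mem_range]
    refine ⟨⟨h1, h2⟩, fun w hw => ?_⟩
    have hwre : |w.re - z.re| < ρ :=
      (Complex.abs_re_le_norm (w - z)).trans_lt (by rwa [← dist_eq_norm])
    have hwim : |w.im - z.im| < ρ :=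
      (Complex.abs_im_le_norm (w - z)).trans_lt (by rwa [← dist_eq_norm])
    have e1 := not_not.1 (h1' h1 w.re hwre)
    have e2 := not_not.1 (h2' h2 w.im hwim)
    simp only [nodeOf, len_natCast, div_div_eq_mul_div, div_one, Prod.mk.injEq]
    exact ⟨trivial, e1, e2⟩
  have hcard : 4 ≤ ((Finset.range 3 \ B1) ×ˢ (Finset.range 3 \ B2)).card := by
    rw [Finset.card_product]
    have c1 : 2 ≤ (Finset.range 3 \ B1).card := by
      have := Finset.card_sdiff_add_card_inter (Finset.range 3) B1
      have h3 : (Finset.range 3).card = 3 := Finset.card_range 3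
      have : (Finset.range 3 ∩ B1).card ≤ 1 := (Finset.card_le_card Finset.inter_subset_right).trans hB1c
      omega
    have c2 : 2 ≤ (Finset.range 3 \ B2).card := by
      have := Finset.card_sdiff_add_card_inter (Finset.range 3) B2
      have h3 : (Finset.range 3).card = 3 := Finset.card_range 3
      have : (Finset.range 3 ∩ B2).card ≤ 1 := (Finset.card_le_card Finset.inter_subset_right).trans hB2c
      omega
    nlinarith
  exact hcard.trans (Finset.card_le_card hsub)

end Dyadic

end Literature.Probability.RandomPlanarGeometry
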